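import Literature.AlgebraicGeometry.Motives.MixedHodgeStructureInternalHomFiltrations
import HarnessLib

/-!
# The internal Hom against the unit: `Hom(ℚ(0), H) ≅ H` and `Hom(H, ℚ(0)) = H^∨`

Two identifications of the internal Hom of mixed `ℚ`-Hodge structures (finite-dimensional) with
the unit object `ℚ(0)` (the tree's `(HodgeStructure.tate 0).toMixedHodgeStructure` on `ℚ`:
`W_{-1} = 0 ⊂ W_0 = ℚ`, `F⁰ = ℂ ⊃ F¹ = 0`):

* **`hom_unit_eq_dual`** — `Hom(H, ℚ(0)) = H^∨` as mixed Hodge structures on the same space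
  `V →ₗ[ℚ] ℚ = Module.Dual ℚ V`: the printed filtrations of the internal Hom (El Zein–Lê, Ch. 3 of
  Cattani–El Zein–Griffiths–Lê, §3.2.2.7 (2), via `mem_hom_W_iff` / `mem_hom_F_iff`) specialise to
  Deligne's dual filtrations `W_r(V^∨) = (W_{-r-1} V)^⊥`, `F^p(V^∨) = (F^{1-p} V)^⊥` (Hodge II, 1.1.6:
  the filtration on a contravariant variable is "par (1.1.6)" the dual one; El Zein–Lê §3.2.2.7:
  "In particular, the dual `H^*` of a mixed Hodge structure `H` is an MHS") — so the tree's
  `MixedHodgeStructure.dual` IS `Hom(−, ℚ(0))`;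
* **`unitHomEval H : Hom (Hom(ℚ(0), H)) H`**, `f ↦ f(1)`, a bijective morphism with inverse
  `unitHomEvalInv` (`v ↦ (q ↦ q • v)`): `Hom(ℚ(0), H) ≅ H` (Deligne–Milne, *Tannakian categories*,
  (1.6.4): `Hom(1, Hom(X, Y)) = Hom(X, Y)`, here with `X = 1`; the forgetful functor is represented
  by the unit), `hodgeNumber_unit_hom`.

All statements are theorems or definitions with bodies; no named fact is introduced.

## References

* [DeligneHodgeII1971] P. Deligne, Théorie de Hodge II, 1.1.6, 1.1.12, 2.1.13.
* [CattaniElZeinGriffithsLe2014] E. Cattani et al. (eds.), Hodge Theory (2014), Ch. 3 §3.2.2.7 (2).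
* [DeligneMilne1982Tannakian] P. Deligne, J. S. Milne, Tannakian categories, LNM 900, §1 (1.6.4).
-/

noncomputable section

open scoped TensorProduct

namespace Literature.AlgebraicGeometry.Motives

namespace MixedHodgeStructure

universe u

variable {V : Type u} [AddCommGroup V] [Module ℚ V]

open Module
open HodgeStructure (homBaseChange homBaseChange_tmul dualBaseChange dualBaseChange_tmul_tmul)

/-! ### Comparison of the two complexifications of `V^∨ = Hom(V, ℚ)` -/

/-- On `ℂ ⊗ Hom_ℚ(V, ℚ) = ℂ ⊗ V^∨`, the comparison maps `homBaseChange V ℚ` (values in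
`Hom_ℂ(V_ℂ, ℂ ⊗ ℚ)`) and `dualBaseChange V` (values in `(V_ℂ)^∨`) agree up to `ℂ ≅ ℂ ⊗ ℚ`:
`homBaseChange ξ x = (dualBaseChange ξ x) ⊗ 1`. [folklore] -/
private theorem homBaseChange_eq_dualBaseChange_tmul (ξ : ℂ ⊗[ℚ] (V →ₗ[ℚ] ℚ)) (x : ℂ ⊗[ℚ] V) :
    homBaseChange V ℚ ξ x = dualBaseChange V ξ x ⊗ₜ[ℚ] (1 : ℚ) := by
  induction ξ using TensorProduct.induction_on with
  | zero => simp only [map_zero, LinearMap.zero_apply, TensorProduct.zero_tmul]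
  | add ξ₁ ξ₂ h₁ h₂ => simp only [map_add, LinearMap.add_apply, TensorProduct.add_tmul, h₁, h₂]
  | tmul c φ =>
    induction x using TensorProduct.induction_on with
    | zero => simp only [map_zero, TensorProduct.zero_tmul]
    | add x y hx hy => simp only [map_add, TensorProduct.add_tmul, hx, hy]
    | tmul d v =>
      rw [homBaseChange_tmul, LinearMap.smul_apply, LinearMap.baseChange_tmul, TensorProduct.smul_tmul',
        smul_eq_mul, dualBaseChange_tmul_tmul, mul_smul_comm, TensorProduct.smul_tmul, smul_eq_mul, mul_one]

/-- `z ⊗ 1 = 0` in `ℂ ⊗_ℚ ℚ` only if `z = 0`. [folklore] -/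
private theorem eq_zero_of_tmul_one_eq_zero {z : ℂ} (h : z ⊗ₜ[ℚ] (1 : ℚ) = (0 : ℂ ⊗[ℚ] ℚ)) : z = 0 := by
  have h' := congrArg (TensorProduct.rid ℚ ℂ) h
  rwa [TensorProduct.rid_tmul, one_smul, map_zero] at h'

variable [FiniteDimensional ℚ V] (H : MixedHodgeStructure V)

/-! ### `Hom(H, ℚ(0)) = H^∨` -/

/-- **`Hom(H, ℚ(0)) = H^∨`**: the internal Hom into the unit object is the dual mixed Hodge structure
— an EQUALITY of MHS on `V →ₗ[ℚ] ℚ = Module.Dual ℚ V`: `W_r Hom(H, ℚ(0)) = {f | f(W_n) ⊆ W_{n+r} ℚ(0) ∀ n}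
= {f | f(W_{-r-1}) = 0} = (W_{-r-1})^⊥` (as `W_m ℚ(0) = 0` exactly for `m < 0`) and
`F^p Hom(H, ℚ(0))_ℂ = {φ | φ(F^n) ⊆ F^{n+p} ℚ(0) ∀ n} = (F^{1-p})^⊥` (as `F^m ℚ(0) = 0` exactly for
`m > 0`) — Deligne, Hodge II, 1.1.6 with 1.1.12; El Zein–Lê §3.2.2.7 ("In particular, the dual `H^*` …
is an MHS"). [cite: DeligneHodgeII1971, 1.1.6 and 1.1.12] [cite: CattaniElZeinGriffithsLe2014, Ch. 3 §3.2.2.7 p. 163] -/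
theorem hom_unit_eq_dual : hom H (HodgeStructure.tate 0).toMixedHodgeStructure = H.dual := by
  refine ext_of_W_F (funext fun r ↦ Submodule.ext fun f ↦ ?_) (funext fun p ↦ Submodule.ext fun ξ ↦ ?_)
  · -- weight filtrations
    rw [mem_hom_W_iff, dual_W, Submodule.mem_dualAnnihilator]
    constructor
    · intro h w hw
      have h1 := h (-r - 1) ⟨w, hw, rfl⟩
      rwa [HodgeStructure.toMixedHodgeStructure_W,
        HodgeStructure.trivialWeightFiltration_of_lt (show -r - 1 + r < -2 * 0 by omega),
        Submodule.mem_bot] at h1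
    · intro h n
      rintro _ ⟨w, hw, rfl⟩
      rw [HodgeStructure.toMixedHodgeStructure_W]
      by_cases hn : n + r < -2 * 0
      · rw [HodgeStructure.trivialWeightFiltration_of_lt hn, Submodule.mem_bot]
        exact h w (H.monotone_W (show n ≤ -r - 1 by omega) hw)
      · rw [HodgeStructure.trivialWeightFiltration_of_le (not_lt.1 hn)]
        exact Submodule.mem_top
  · -- Hodge filtrations
    rw [mem_hom_F_iff, dual_F, Submodule.mem_comap, Submodule.mem_dualAnnihilator]
    constructor
    · intro h x hx
      have h1 := h (1 - p) ⟨x, hx, rfl⟩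
      rw [HodgeStructure.toMixedHodgeStructure_F, HodgeStructure.tate_F,
        HodgeStructure.pureFiltration_of_lt (show -0 < 1 - p + p by omega), Submodule.mem_bot,
        homBaseChange_eq_dualBaseChange_tmul] at h1
      exact eq_zero_of_tmul_one_eq_zero h1
    · intro h n
      rintro _ ⟨x, hx, rfl⟩
      rw [HodgeStructure.toMixedHodgeStructure_F, HodgeStructure.tate_F]
      by_cases hn : n + p ≤ -0
      · rw [HodgeStructure.pureFiltration_of_le hn]
        exact Submodule.mem_top
      · rw [HodgeStructure.pureFiltration_of_lt (not_le.1 hn), Submodule.mem_bot,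
          homBaseChange_eq_dualBaseChange_tmul, h x (H.antitone_F (show 1 - p ≤ n by omega) hx),
          TensorProduct.zero_tmul]

/-- The `(0,0)`-classes of `Hom(H, ℚ(0)) = H^∨` are the morphisms `H → ℚ(0)`: a linear form is a
morphism of MHS to the unit iff it lies in `W_0(H^∨) ∩ F⁰(H^∨)`, i.e. kills `W_{-1} H` and
(complexified) `F¹ H_ℂ`. [cite: DeligneHodgeII1971, 1.1.6 and 1.1.12] -/
theorem isHom_unit_iff_mem_hodgeClasses_dual (f : V →ₗ[ℚ] ℚ) :
    IsHom H (HodgeStructure.tate 0).toMixedHodgeStructure f ↔ f ∈ H.dual.hodgeClasses 0 := by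
  rw [← mem_hodgeClasses_hom_zero_iff, hom_unit_eq_dual]

/-! ### `Hom(ℚ(0), H) ≅ H` -/

variable {V' : Type*} [AddCommGroup V'] [Module ℚ V']

/-- The complexification of `f ↦ f(1)` is evaluation of `homBaseChange` at `1 ⊗ 1`. [folklore] -/
private theorem ringLmapEquivSelf_baseChange (ξ : ℂ ⊗[ℚ] (ℚ →ₗ[ℚ] V')) :
    (LinearMap.ringLmapEquivSelf ℚ ℚ V' : (ℚ →ₗ[ℚ] V') →ₗ[ℚ] V').baseChange ℂ ξ =
      homBaseChange ℚ V' ξ ((1 : ℂ) ⊗ₜ[ℚ] (1 : ℚ)) := by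
  induction ξ using TensorProduct.induction_on with
  | zero => simp only [map_zero, LinearMap.zero_apply]
  | add x y hx hy => simp only [map_add, LinearMap.add_apply, hx, hy]
  | tmul c f =>
    rw [LinearMap.baseChange_tmul, LinearEquiv.coe_coe, LinearMap.ringLmapEquivSelf_apply,
      homBaseChange_tmul, LinearMap.smul_apply, LinearMap.baseChange_tmul, TensorProduct.smul_tmul',
      smul_eq_mul, mul_one]

variable [FiniteDimensional ℚ V'] (H' : MixedHodgeStructure V')

/-- **`Hom(ℚ(0), H) → H`, `f ↦ f(1)`, is a morphism of mixed Hodge structures**: `1 ∈ W_0 ℚ(0)` and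
`1 ⊗ 1 ∈ F⁰ ℚ(0)_ℂ`, so `f ∈ W_r Hom` gives `f(1) ∈ W_r H` and `φ ∈ F^p Hom_ℂ` gives `φ(1 ⊗ 1) ∈ F^p H_ℂ`
(`mem_hom_W_iff`, `mem_hom_F_iff`). With `unitHomEvalInv` this is the isomorphism `Hom(ℚ(0), H) ≅ H`
(Deligne–Milne (1.6.4): `Hom(1, Hom(X,Y)) = Hom(1 ⊗ X, Y) = Hom(X, Y)`; the unit represents the
forgetful functor). [cite: DeligneMilne1982Tannakian, §1 (1.6.4)] [cite: DeligneHodgeII1971, 1.1.12] -/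
def unitHomEval : Hom (hom (HodgeStructure.tate 0).toMixedHodgeStructure H') H' where
  toLinearMap := (LinearMap.ringLmapEquivSelf ℚ ℚ V' : (ℚ →ₗ[ℚ] V') →ₗ[ℚ] V')
  map_W_le r := by
    rintro _ ⟨f, hf, rfl⟩
    rw [SetLike.mem_coe, mem_hom_W_iff] at hf
    rw [LinearEquiv.coe_coe, LinearMap.ringLmapEquivSelf_apply]
    have h1 := hf 0 ⟨1, by
      rw [HodgeStructure.toMixedHodgeStructure_W,
        HodgeStructure.trivialWeightFiltration_of_le (show -2 * 0 ≤ (0 : ℤ) by omega)]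
      exact Submodule.mem_top, rfl⟩
    rwa [zero_add] at h1
  map_F_le p := by
    rintro _ ⟨ξ, hξ, rfl⟩
    rw [SetLike.mem_coe, mem_hom_F_iff] at hξ
    rw [ringLmapEquivSelf_baseChange]
    have h1 := hξ 0 ⟨(1 : ℂ) ⊗ₜ[ℚ] (1 : ℚ), by
      rw [HodgeStructure.toMixedHodgeStructure_F, HodgeStructure.tate_F,
        HodgeStructure.pureFiltration_of_le (show (0 : ℤ) ≤ -0 by omega)]
      exact Submodule.mem_top, rfl⟩
    rwa [zero_add] at h1

/-- The underlying map of `unitHomEval` is `f ↦ f(1)` (Mathlib's `LinearMap.ringLmapEquivSelf`).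
[cite: DeligneMilne1982Tannakian, §1 (1.6.4)] -/
@[simp]
theorem unitHomEval_toLinearMap_apply (f : ℚ →ₗ[ℚ] V') : (unitHomEval H').toLinearMap f = f 1 :=
  rfl

/-- `unitHomEval` is bijective (`Hom_ℚ(ℚ, V') ≅ V'`). [cite: DeligneMilne1982Tannakian, §1 (1.6.4)] -/
theorem unitHomEval_bijective : Function.Bijective (unitHomEval H').toLinearMap :=
  (LinearMap.ringLmapEquivSelf ℚ ℚ V').bijective

/-- **The inverse isomorphism `H → Hom(ℚ(0), H)`, `v ↦ (q ↦ q • v)`** — a morphism of MHS as the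
inverse of the bijective morphism `unitHomEval` (strictness, El Zein–Lê Thm. 3.2.18; the tree's
`Hom.inverse`). [cite: DeligneMilne1982Tannakian, §1 (1.6.4)] [cite: CattaniElZeinGriffithsLe2014, Thm. 3.2.18] -/
def unitHomEvalInv : Hom H' (hom (HodgeStructure.tate 0).toMixedHodgeStructure H') :=
  (unitHomEval H').inverse (unitHomEval_bijective H')

/-- `unitHomEvalInv ∘ unitHomEval = id`. [cite: DeligneMilne1982Tannakian, §1 (1.6.4)] -/
theorem unitHomEvalInv_comp_unitHomEval :
    (unitHomEvalInv H').comp (unitHomEval H') = Hom.id _ :=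
  Hom.inverse_comp _ _

/-- `unitHomEval ∘ unitHomEvalInv = id`. [cite: DeligneMilne1982Tannakian, §1 (1.6.4)] -/
theorem unitHomEval_comp_unitHomEvalInv :
    (unitHomEval H').comp (unitHomEvalInv H') = Hom.id H' :=
  Hom.comp_inverse _ _

/-- The underlying map of `unitHomEvalInv`: `v ↦ (q ↦ q • v)`. [cite: DeligneMilne1982Tannakian, §1 (1.6.4)] -/
theorem unitHomEvalInv_toLinearMap_apply (v : V') (q : ℚ) :
    (unitHomEvalInv H').toLinearMap v q = q • v := by
  have h1 : (unitHomEvalInv H').toLinearMap v 1 = v := by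
    have h := congrArg (fun φ : Hom H' H' ↦ φ.toLinearMap v) (unitHomEval_comp_unitHomEvalInv H')
    simpa only [Hom.comp_toLinearMap, LinearMap.comp_apply, unitHomEval_toLinearMap_apply,
      Hom.id_toLinearMap, LinearMap.id_apply] using h
  calc (unitHomEvalInv H').toLinearMap v q = (unitHomEvalInv H').toLinearMap v (q • (1 : ℚ)) := by
        rw [smul_eq_mul, mul_one]
    _ = q • v := by rw [map_smul, h1]

/-- **`h^{p,q}(Hom(ℚ(0), H)) = h^{p,q}(H)`.** [cite: DeligneMilne1982Tannakian, §1 (1.6.4)] -/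
theorem hodgeNumber_unit_hom (p q : ℤ) :
    (hom (HodgeStructure.tate 0).toMixedHodgeStructure H').hodgeNumber p q = H'.hodgeNumber p q :=
  Hom.hodgeNumber_eq_of_bijective (unitHomEval H') (unitHomEval_bijective H') p q

/-- **`h^{p,q}(Hom(H, ℚ(0))) = h^{-p,-q}(H)`** (`Hom(H, ℚ(0)) = H^∨` and `hodgeNumber_dual`).
[cite: CattaniElZeinGriffithsLe2014, Ch. 3 §3.2.2.7 p. 163] -/
theorem hodgeNumber_hom_unit (p q : ℤ) :
    (hom H (HodgeStructure.tate 0).toMixedHodgeStructure).hodgeNumber p q = H.hodgeNumber (-p) (-q) := by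
  rw [hom_unit_eq_dual, hodgeNumber_dual]

end MixedHodgeStructure

end Literature.AlgebraicGeometry.Motives

end
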